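import Summits.Parity.GeneralizedHardyLittlewood.Theorems.PrimeLevelFamEdgeMomentsBeyondDiagonalDiagRieszRecursion
import HarnessLib

/-!
# Route `PrimeLevelFamEdge`, crux K_A `MomentsBeyondDiagonal` (stmt-Parity-20007), line «petersson_layers» v4, stub `stub_diag`:
# **the logarithmic Riesz means of `(μ ∗ μ)(k)/k` of every order** —
# `R⁽ᶜ⁾(z) = Σ_{k ≤ z} (μ∗μ)(k) k⁻¹ logᶜ(z/k) = c(c−1)·log^{c−2} z + O_c((1 + log z)^{c−3})` (`c ≥ 3`)

Census item R3(i) of the `stub_diag` roadmap: for the profile `X^c` of an admissible `P = Σ_{c≥2} p_c X^c`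
the Selberg-coordinate rearrangement of K_B's kernel form (`KernelFormXSqCore`) produces the ORDER-`c`
logarithmic Riesz mean of `(μ∗μ)/id`, `R⁽ᶜ⁾(z) = Σ_{k ≤ z} (G∗G)(k)·logᶜ(z/k)` (`G = μ/id`), whose main
term is `res_{s=0} c!·z^s s^{−c−1}ζ(1+s)⁻² = c(c−1) log^{c−2} z + (lower)`. This file proves, for every
`c ≥ 3` and uniformly in `z ≥ 1`,

* `abs_flatRiesz_sub_le` — **`|R⁽ᶜ⁾(z) − c(c−1)·log^{c−2} z| ≤ C_c·(1 + log z)^{c−3}`**,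
* `abs_flatRiesz_le` — the crude bound `|R⁽ᶜ⁾(z)| ≤ C·(1 + log z)^{c−2}` (`c ≥ 2`),

exactly the precision the `X^c × X^{c'}` cross terms of the kernel form need (relative `O(1/log)`; the
`(2,2)` term needs the tree's `O(log⁻²)`, `KernelFormXSqRiesz`).

METHOD (real variables): by the exact recursion `R⁽ᶜ⁺¹⁾(z) = ∫₁^z (c+1)R⁽ᶜ⁾(w) dw/w`
(`…DiagRieszRecursion.flatRiesz_succ_eq_integral`) the tree's `R⁽²⁾ = 2 + O((1+log)⁻²)` integrates to
`R⁽³⁾ = 6 log z + O(1)` (`∫₁^∞ dw/(w(1+log w)²) = 1`) and then inductively to every order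
(`∫₁^z (1+log w)^m dw/w = ((1+log z)^{m+1} − 1)/(m+1)`). Def-free; theorems only.
Helper `--supports stmt-Parity-20007`; closes nothing; K_A, K_B and the Parity summit are NOT proved; nothing
about Landau–Siegel zeros.

## References
* H. L. Montgomery, R. C. Vaughan, *Multiplicative Number Theory I*, CUP 2007, §8.1 (8.6)–(8.8) and §5.1.
  [cite: MontgomeryVaughan2007, §8.1 — derivation]
* E. Kowalski, P. Michel, J. VanderKam, J. reine angew. Math. 526 (2000), Prop. 5.1 p. 18 and (23)–(28)
  pp. 13–15 (the residues these real-variable means replace). [cite: KowalskiMichelVanderKam2000, Prop. 5.1 — derivation]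
-/

noncomputable section

open scoped Real ArithmeticFunction.Moebius
open Finset ArithmeticFunction MeasureTheory intervalIntegral

namespace Summit.Parity.GeneralizedHardyLittlewood.Theorems.MomentsBeyondDiagonal.DiagKernel

open Literature.NumberTheory.LFunctions Literature.NumberTheory.LFunctions.KMV2000
open MollifierMainTerm (G moebiusRiesz)

/-! ### `R⁽³⁾(z) = 6 log z + O(1)` and the induction to every order -/

/-- **`R⁽³⁾(z) = 6 log z + O(1)`**: `|Σ_{k ≤ z} (G∗G)(k) log³(z/k) − 6 log z| ≤ C` for `z ≥ 1`
(`R⁽³⁾ = 3∫₁^z R⁽²⁾ dw/w`, `R⁽²⁾ = 2 + O((1+log w)⁻²)`, `∫₁^∞ dw/(w(1 + log w)²) = 1`).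
[cite: MontgomeryVaughan2007, §8.1 — derivation (third Riesz mean of 1/ζ²)] -/
theorem abs_flatRiesz_three_sub_le :
    ∃ C : ℝ, 0 < C ∧ ∀ z : ℝ, 1 ≤ z →
      |∑ k ∈ Icc 1 ⌊z⌋₊, (G * G) k * Real.log (z / k) ^ 3 - 6 * Real.log z| ≤ C := by
  obtain ⟨C₂, hC₂, h2⟩ := abs_flatRiesz_two_sub_two_le
  refine ⟨3 * C₂, by positivity, fun z hz ↦ ?_⟩
  have hz0 : 0 < z := zero_lt_one.trans_le hz
  have hne : ∀ w ∈ Set.uIcc 1 z, w ≠ 0 := by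
    intro w hw
    rw [Set.uIcc_of_le hz] at hw
    exact (zero_lt_one.trans_le hw.1).ne'
  set F : ℝ → ℝ := fun w ↦ ∑ k ∈ Icc 1 ⌊z⌋₊,
    (G * G) k * ((((2 : ℕ) : ℝ) + 1) * Real.posLog (w / k) ^ 2 / w) with hFdef
  have hR : ∑ k ∈ Icc 1 ⌊z⌋₊, (G * G) k * Real.log (z / k) ^ 3 = ∫ w in (1 : ℝ)..z, F w :=
    flatRiesz_succ_eq_integral (fun k ↦ (G * G) k) (c := 2) (by norm_num) hz
  have hmain : 6 * Real.log z = ∫ w in (1 : ℝ)..z, 6 * (Real.log w ^ 0 / w) := by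
    rw [intervalIntegral.integral_const_mul, integral_log_pow_div hz 0]
    ring
  have hFint : IntervalIntegrable F volume 1 z := by
    refine ContinuousOn.intervalIntegrable (continuousOn_finsetSum _ fun k _ ↦ continuousOn_const.mul ?_)
    exact continuousOn_const_mul_posLog_pow_div _ (k : ℝ) 2 hne
  have hGint : IntervalIntegrable (fun w : ℝ ↦ 6 * (Real.log w ^ 0 / w)) volume 1 z := by
    refine ContinuousOn.intervalIntegrable (continuousOn_const.mul ?_)
    exact ((continuousOn_id.log hne).pow 0).div continuousOn_id hne
  have hBint : IntervalIntegrable (fun w : ℝ ↦ 3 * C₂ * (1 / ((1 + Real.log w) ^ 2 * w))) volume 1 z := by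
    refine ContinuousOn.intervalIntegrable (continuousOn_const.mul ?_)
    have hlog : ∀ w ∈ Set.uIcc 1 z, 1 + Real.log w ≠ 0 := by
      intro w hw
      rw [Set.uIcc_of_le hz] at hw
      have := Real.log_nonneg hw.1
      positivity
    refine continuousOn_const.div ?_ fun w hw ↦ mul_ne_zero (pow_ne_zero 2 (hlog w hw)) (hne w hw)
    exact ((continuousOn_const.add (continuousOn_id.log hne)).pow 2).mul continuousOn_id
  rw [hR, hmain, ← intervalIntegral.integral_sub hFint hGint]
  have hbound : ∀ᵐ w : ℝ, w ∈ Set.Ioc 1 z →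
      ‖F w - 6 * (Real.log w ^ 0 / w)‖ ≤ 3 * C₂ * (1 / ((1 + Real.log w) ^ 2 * w)) := by
    refine Filter.Eventually.of_forall fun w hw ↦ ?_
    have hw1 : 1 ≤ w := hw.1.le
    have hw0 : 0 < w := zero_lt_one.trans_le hw1
    have hwz : ⌊w⌋₊ ≤ ⌊z⌋₊ := Nat.floor_le_floor hw.2
    have hFw : F w = (((2 : ℕ) : ℝ) + 1) / w * ∑ k ∈ Icc 1 ⌊w⌋₊, (G * G) k * Real.log (w / k) ^ 2 := by
      rw [hFdef]
      exact sum_posLog_pow_eq (fun k ↦ (G * G) k) (c := 2) (by norm_num) hw1 hwz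
    have hlog0 : 0 ≤ Real.log w := Real.log_nonneg hw1
    have key : F w - 6 * (Real.log w ^ 0 / w) =
        3 / w * (∑ k ∈ Icc 1 ⌊w⌋₊, (G * G) k * Real.log (w / k) ^ 2 - 2) := by
      rw [hFw]; push_cast; ring
    rw [key, Real.norm_eq_abs, abs_mul, abs_of_pos (by positivity : (0 : ℝ) < 3 / w)]
    calc 3 / w * |∑ k ∈ Icc 1 ⌊w⌋₊, (G * G) k * Real.log (w / k) ^ 2 - 2|
        ≤ 3 / w * (C₂ / (1 + Real.log w) ^ 2) :=
          mul_le_mul_of_nonneg_left (h2 w hw1) (by positivity)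
      _ = 3 * C₂ * (1 / ((1 + Real.log w) ^ 2 * w)) := by
          field_simp
  refine (Real.norm_eq_abs _ ▸ norm_integral_le_of_norm_le hz hbound hBint).trans ?_
  rw [intervalIntegral.integral_const_mul, integral_inv_mul_one_add_log_sq hz]
  have hL : 0 ≤ Real.log z := Real.log_nonneg hz
  have : 0 ≤ 1 / (1 + Real.log z) := by positivity
  nlinarith

/-- **Every order, by induction**: for all `m`, `|R⁽ᵐ⁺³⁾(z) − (m+3)(m+2) log^{m+1} z| ≤ C_m (1 + log z)^m`
for `z ≥ 1` (`R⁽ᶜ⁺¹⁾ = (c+1)∫₁^z R⁽ᶜ⁾dw/w`, `∫₁^z (1+log w)^m dw/w ≤ (1+log z)^{m+1}/(m+1)`).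
[cite: MontgomeryVaughan2007, §8.1 — derivation (Riesz means of 1/ζ² of every order)] -/
theorem abs_flatRiesz_add_three_sub_le (m : ℕ) :
    ∃ C : ℝ, 0 < C ∧ ∀ z : ℝ, 1 ≤ z →
      |∑ k ∈ Icc 1 ⌊z⌋₊, (G * G) k * Real.log (z / k) ^ (m + 3) -
          ((m : ℝ) + 3) * ((m : ℝ) + 2) * Real.log z ^ (m + 1)| ≤ C * (1 + Real.log z) ^ m := by
  induction m with
  | zero =>
    obtain ⟨C, hC, h⟩ := abs_flatRiesz_three_sub_le
    refine ⟨C, hC, fun z hz ↦ ?_⟩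
    have := h z hz
    norm_num
    simpa using this
  | succ m ih =>
    obtain ⟨C, hC, h⟩ := ih
    refine ⟨((m : ℝ) + 4) * C / ((m : ℝ) + 1), by positivity, fun z hz ↦ ?_⟩
    have hz0 : 0 < z := zero_lt_one.trans_le hz
    have hne : ∀ w ∈ Set.uIcc 1 z, w ≠ 0 := by
      intro w hw
      rw [Set.uIcc_of_le hz] at hw
      exact (zero_lt_one.trans_le hw.1).ne'
    have hc1 : 1 ≤ m + 3 := by omega
    set F : ℝ → ℝ := fun w ↦ ∑ k ∈ Icc 1 ⌊z⌋₊,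
      (G * G) k * (((m + 3 : ℕ) + 1 : ℝ) * Real.posLog (w / k) ^ (m + 3) / w) with hFdef
    have hR : ∑ k ∈ Icc 1 ⌊z⌋₊, (G * G) k * Real.log (z / k) ^ (m + 1 + 3) = ∫ w in (1 : ℝ)..z, F w := by
      rw [show m + 1 + 3 = (m + 3) + 1 by ring]
      exact flatRiesz_succ_eq_integral (fun k ↦ (G * G) k) hc1 hz
    -- the main term as an integral
    set A : ℝ := ((m : ℝ) + 4) * (((m : ℝ) + 3) * ((m : ℝ) + 2)) with hAdef
    have hmain : (((m + 1 : ℕ) : ℝ) + 3) * (((m + 1 : ℕ) : ℝ) + 2) * Real.log z ^ (m + 1 + 1) =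
        ∫ w in (1 : ℝ)..z, A * (Real.log w ^ (m + 1) / w) := by
      rw [intervalIntegral.integral_const_mul, integral_log_pow_div hz (m + 1), hAdef]
      push_cast
      field_simp
      ring
    have hFint : IntervalIntegrable F volume 1 z := by
      refine ContinuousOn.intervalIntegrable
        (continuousOn_finsetSum _ fun k _ ↦ continuousOn_const.mul ?_)
      exact continuousOn_const_mul_posLog_pow_div _ (k : ℝ) (m + 3) hne
    have hGint : IntervalIntegrable (fun w : ℝ ↦ A * (Real.log w ^ (m + 1) / w)) volume 1 z := by
      refine ContinuousOn.intervalIntegrable (continuousOn_const.mul ?_)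
      exact ((continuousOn_id.log hne).pow (m + 1)).div continuousOn_id hne
    have hBint : IntervalIntegrable
        (fun w : ℝ ↦ ((m : ℝ) + 4) * C * ((1 + Real.log w) ^ m / w)) volume 1 z := by
      refine ContinuousOn.intervalIntegrable (continuousOn_const.mul ?_)
      exact ((continuousOn_const.add (continuousOn_id.log hne)).pow m).div continuousOn_id hne
    rw [hR, hmain, ← intervalIntegral.integral_sub hFint hGint]
    have hbound : ∀ᵐ w : ℝ, w ∈ Set.Ioc 1 z →
        ‖F w - A * (Real.log w ^ (m + 1) / w)‖ ≤ ((m : ℝ) + 4) * C * ((1 + Real.log w) ^ m / w) := by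
      refine Filter.Eventually.of_forall fun w hw ↦ ?_
      have hw1 : 1 ≤ w := hw.1.le
      have hw0 : 0 < w := zero_lt_one.trans_le hw1
      have hwz : ⌊w⌋₊ ≤ ⌊z⌋₊ := Nat.floor_le_floor hw.2
      have hFw : F w = (((m + 3 : ℕ) : ℝ) + 1) / w *
          ∑ k ∈ Icc 1 ⌊w⌋₊, (G * G) k * Real.log (w / k) ^ (m + 3) := by
        rw [hFdef]
        exact sum_posLog_pow_eq (fun k ↦ (G * G) k) hc1 hw1 hwz
      have key : F w - A * (Real.log w ^ (m + 1) / w) =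
          ((m : ℝ) + 4) / w * (∑ k ∈ Icc 1 ⌊w⌋₊, (G * G) k * Real.log (w / k) ^ (m + 3) -
            ((m : ℝ) + 3) * ((m : ℝ) + 2) * Real.log w ^ (m + 1)) := by
        rw [hFw, hAdef]; push_cast; field_simp; ring
      rw [key, Real.norm_eq_abs, abs_mul, abs_of_pos (by positivity : (0 : ℝ) < ((m : ℝ) + 4) / w)]
      calc ((m : ℝ) + 4) / w * |∑ k ∈ Icc 1 ⌊w⌋₊, (G * G) k * Real.log (w / k) ^ (m + 3) -
              ((m : ℝ) + 3) * ((m : ℝ) + 2) * Real.log w ^ (m + 1)|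
          ≤ ((m : ℝ) + 4) / w * (C * (1 + Real.log w) ^ m) :=
            mul_le_mul_of_nonneg_left (h w hw1) (by positivity)
        _ = ((m : ℝ) + 4) * C * ((1 + Real.log w) ^ m / w) := by
            field_simp
    refine (Real.norm_eq_abs _ ▸ norm_integral_le_of_norm_le hz hbound hBint).trans ?_
    rw [intervalIntegral.integral_const_mul, integral_one_add_log_pow_div hz m]
    have hL : 0 ≤ Real.log z := Real.log_nonneg hz
    have h1 : 1 ≤ (1 + Real.log z) ^ (m + 1) := one_le_pow₀ (by linarith)
    have hm1 : (0 : ℝ) < (m : ℝ) + 1 := by positivity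
    rw [show ((m : ℝ) + 4) * C * (((1 + Real.log z) ^ (m + 1) - 1) / ((m : ℝ) + 1)) =
      ((m : ℝ) + 4) * C / ((m : ℝ) + 1) * ((1 + Real.log z) ^ (m + 1) - 1) by
        field_simp]
    have hK : 0 ≤ ((m : ℝ) + 4) * C / ((m : ℝ) + 1) := by positivity
    nlinarith

/-- **The logarithmic Riesz mean of `(μ∗μ)/id` of order `c ≥ 3`**:
`|Σ_{k ≤ z} (G∗G)(k)·logᶜ(z/k) − c(c−1)·log^{c−2} z| ≤ C_c·(1 + log z)^{c−3}` for all `z ≥ 1`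
(`G = μ/id`; the real-variable form of `res_{s=0} c!·z^s s^{−c−1}ζ(1+s)⁻²` to relative precision
`O(1/log z)`). [cite: MontgomeryVaughan2007, §8.1 — derivation (Riesz means of 1/ζ² of every order)] -/
theorem abs_flatRiesz_sub_le {c : ℕ} (hc : 3 ≤ c) :
    ∃ C : ℝ, 0 < C ∧ ∀ z : ℝ, 1 ≤ z →
      |∑ k ∈ Icc 1 ⌊z⌋₊, (G * G) k * Real.log (z / k) ^ c -
          (c : ℝ) * ((c : ℝ) - 1) * Real.log z ^ (c - 2)| ≤ C * (1 + Real.log z) ^ (c - 3) := by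
  obtain ⟨m, rfl⟩ : ∃ m, c = m + 3 := ⟨c - 3, by omega⟩
  obtain ⟨C, hC, h⟩ := abs_flatRiesz_add_three_sub_le m
  refine ⟨C, hC, fun z hz ↦ ?_⟩
  have e1 : m + 3 - 2 = m + 1 := by omega
  have e2 : m + 3 - 3 = m := by omega
  rw [e1, e2]
  have := h z hz
  push_cast
  rw [show ((m : ℝ) + 3) * ((m : ℝ) + 3 - 1) = ((m : ℝ) + 3) * ((m : ℝ) + 2) by ring]
  exact this

/-- **Crude size of the Riesz means of order `c ≥ 2`**: `|Σ_{k ≤ z} (G∗G)(k)·logᶜ(z/k)| ≤ C·(1 + log z)^{c−2}`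
for `z ≥ 1`. [cite: MontgomeryVaughan2007, §8.1 — derivation] -/
theorem abs_flatRiesz_le {c : ℕ} (hc : 2 ≤ c) :
    ∃ C : ℝ, 0 < C ∧ ∀ z : ℝ, 1 ≤ z →
      |∑ k ∈ Icc 1 ⌊z⌋₊, (G * G) k * Real.log (z / k) ^ c| ≤ C * (1 + Real.log z) ^ (c - 2) := by
  rcases eq_or_lt_of_le hc with rfl | hc3
  · obtain ⟨C, hC, h⟩ := abs_flatRiesz_two_sub_two_le
    refine ⟨C + 2, by positivity, fun z hz ↦ ?_⟩
    have hL : 0 ≤ Real.log z := Real.log_nonneg hz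
    have h1 := h z hz
    have h2 : C / (1 + Real.log z) ^ 2 ≤ C := div_le_self hC.le (one_le_pow₀ (by linarith))
    have h3 : |∑ k ∈ Icc 1 ⌊z⌋₊, (G * G) k * Real.log (z / k) ^ 2| ≤
        |∑ k ∈ Icc 1 ⌊z⌋₊, (G * G) k * Real.log (z / k) ^ 2 - 2| + |(2 : ℝ)| := by
      have := abs_add_le (∑ k ∈ Icc 1 ⌊z⌋₊, (G * G) k * Real.log (z / k) ^ 2 - 2) 2
      simpa using this
    rw [abs_two] at h3
    simp only [Nat.sub_self, pow_zero, mul_one]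
    linarith
  · have hc3' : 3 ≤ c := hc3
    obtain ⟨C, hC, h⟩ := abs_flatRiesz_sub_le hc3'
    refine ⟨C + (c : ℝ) * ((c : ℝ) - 1), ?_, fun z hz ↦ ?_⟩
    · have : (3 : ℝ) ≤ c := by exact_mod_cast hc3'
      nlinarith
    have hL : 0 ≤ Real.log z := Real.log_nonneg hz
    have h1 := h z hz
    have hc1 : (1 : ℝ) ≤ c := by exact_mod_cast (by omega : 1 ≤ c)
    have hcc : 0 ≤ (c : ℝ) * ((c : ℝ) - 1) := by nlinarith
    have hpow1 : (1 + Real.log z) ^ (c - 3) ≤ (1 + Real.log z) ^ (c - 2) :=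
      pow_le_pow_right₀ (by linarith) (by omega)
    have hpow2 : Real.log z ^ (c - 2) ≤ (1 + Real.log z) ^ (c - 2) :=
      pow_le_pow_left₀ hL (by linarith) _
    have h3 : |∑ k ∈ Icc 1 ⌊z⌋₊, (G * G) k * Real.log (z / k) ^ c| ≤
        |∑ k ∈ Icc 1 ⌊z⌋₊, (G * G) k * Real.log (z / k) ^ c -
            (c : ℝ) * ((c : ℝ) - 1) * Real.log z ^ (c - 2)| +
          |(c : ℝ) * ((c : ℝ) - 1) * Real.log z ^ (c - 2)| := by
      have := abs_add_le (∑ k ∈ Icc 1 ⌊z⌋₊, (G * G) k * Real.log (z / k) ^ c -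
        (c : ℝ) * ((c : ℝ) - 1) * Real.log z ^ (c - 2)) ((c : ℝ) * ((c : ℝ) - 1) * Real.log z ^ (c - 2))
      simpa using this
    rw [abs_of_nonneg (by positivity : (0 : ℝ) ≤ (c : ℝ) * ((c : ℝ) - 1) * Real.log z ^ (c - 2))] at h3
    calc _ ≤ C * (1 + Real.log z) ^ (c - 3) + (c : ℝ) * ((c : ℝ) - 1) * Real.log z ^ (c - 2) := by
          linarith
      _ ≤ C * (1 + Real.log z) ^ (c - 2) + (c : ℝ) * ((c : ℝ) - 1) * (1 + Real.log z) ^ (c - 2) := by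
          gcongr
      _ = (C + (c : ℝ) * ((c : ℝ) - 1)) * (1 + Real.log z) ^ (c - 2) := by ring

end Summit.Parity.GeneralizedHardyLittlewood.Theorems.MomentsBeyondDiagonal.DiagKernel

end
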